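import Summits.BirchSwinnertonDyer.BirchSwinnertonDyer.Theorems.GoldfeldK12AdditiveTwoDescent
import Literature.NumberTheory.EllipticCurves.BSDHeegnerPointsModularityOnlyProofs
import HarnessLib

set_option linter.dupNamespace false
set_option autoImplicit false

/-!
# Crux K12₂″ along route B at `p = 2`, one level down: the `K`-level leaf IS the non-torsion of the
# Heegner point (Gross–Zagier needs no hypothesis at `2`)

Cell `bsd-goldfeld`, prover seat `s1p-c201`, file 5 (TARGET §2 s1p-c201 STEP B; companion of
`GoldfeldK12AdditiveTwoDescent`, p418688, whose leaf `KLevelTwoConverseCMSevenSplit` is stub (3) of the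
planner's skeleton line `heegner-field-at-two`). Item stmt-BirchSwinnertonDyer-20044.

For `W` (globally minimal, `j = −3375`, NOT good at `2`) and an auxiliary imaginary quadratic `K` as in
that leaf (every `ℓ ∣ N_W` split — the classical Heegner hypothesis for `X₀(N_W)` —, `2` split,
`d_K ≡ 1 (mod 8)`, `L(W^{(d_K)}, 1) ≠ 0`), the modular parametrisation `X₀(N_W) → W` gives a Heegner
point `P_K ∈ W(K)` (tree fact `exists_isHeegnerPoint`, Gross 1984 / Gross–Zagier I.§4), and by
Gross–Zagier (tree fact `gross_zagier`, Thm. I.6.3; constant positive) with the sign `−1`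
(`one_le_analyticRankEK_of_exists_isNewformOf`, from Modularity): `ord_{s=1} L(W/K, s) = 1 ⟺ P_K` has
infinite order (tree theorem `analyticRankEK_eq_one_iff_heegner_nonTorsion_of_exists_isNewformOf`).
None of this sees the prime `2`. Hence:

* `HeegnerNonTorsionCMSevenAdditiveTwo` (**OPEN, `@[conjecture]`, nothing asserted**): for such
  `(W, K)`, `corank_{ℤ₂} Sel_{2^∞}(W/K) = 1 ⟹` every Heegner point of level `N_W` in `W(K)` has infinite
  order — "Kolyvagin's conjecture at `p = 2`, consequence form" for the additive `ℚ(√−7)`-twists;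
* `kLevelTwoConverseCMSevenSplit_iff_heegnerNonTorsion hmod hGZ hHP`: the route-B leaf ⟺ this
  statement, granted Modularity, Gross–Zagier and the `K`-rationality of Heegner points;
* `rankOneTwoConverseCMSevenAdditiveTwo_of_heegnerNonTorsion`: the crux K12₂″ (route decl, by name)
  from `2`-parity, Modularity, Hoffstein–Luo, Kato at `2` (or GZK), Gross–Zagier, Heegner existence and
  `HeegnerNonTorsionCMSevenAdditiveTwo`.

So along route B the entire `2`-adic content of K12₂″ is: a `2^∞`-Selmer class of corank one over the
Heegner field forces the Heegner point off the torsion — the statement a `2`-adic Heegner-point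
Kolyvagin-system / anticyclotomic argument would have to deliver (printed only for `p` odd:
W. Zhang 2014, Burungale–Castella–Grossi–Skinner 2026; here moreover `W(ℚ)[2] ≠ 0` and `2 ∣ N_W`).

References: B. Gross, D. Zagier, Invent. Math. 84 (1986) Thm. I.6.3, I.§7 [GrossZagier1986];
L. Cai, J. Shu, Y. Tian, Algebra Number Theory 8 (2014) Thm. 1.1 [CaiShuTian2014]; B. Gross, in
*L-functions and Arithmetic* (1991) (1.1), Thm. 1.3 [Gross1991]; W. Zhang, Camb. J. Math. 2 (2014);
A. Burungale, F. Castella, G. Grossi, C. Skinner, arXiv:2312.09301 Thm. 1 [BurungaleEtAl2026];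
A. Burungale, F. Castella, C. Skinner, Y. Tian, Ann. Math. Qué. 46 (2022) Rem. D [BurungaleCastellaSkinnerTian2022].
-/

noncomputable section

open scoped Classical

open WeierstrassCurve Literature.NumberTheory.EllipticCurves

namespace Summit.BirchSwinnertonDyer.BirchSwinnertonDyer.Theorems.GoldfeldGoodTwists

/-! ## §1 The leaf one level down: Heegner points off the torsion -/

/-- **LEAF `HeegnerNonTorsionCMSevenAdditiveTwo` (OPEN; nothing asserted).** For every globally minimal
elliptic `W/ℚ` with `j(W) = −3375`, NOT good at `2`, and every imaginary quadratic `K` with every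
`ℓ ∣ N_W` split, `2` split, `d_K ≡ 1 (mod 8)` and `L(W^{(d_K)}, 1) ≠ 0`:
`corank_{ℤ₂} Sel_{2^∞}(W/K) = 1 ⟹` every Heegner point `P_K ∈ W(K)` of level `N_W` (`IsHeegnerPoint`:
trace to `K` of a CM point of `X₀(N_W)` under the modular parametrisation) has infinite order.
The `p = 2`, residually reducible, `2 ∣ N` case of "Kolyvagin's conjecture ⟹ non-torsion in corank
one" (printed for odd `p`). Equivalent to `KLevelTwoConverseCMSevenSplit` modulo Gross–Zagier and
Modularity (`kLevelTwoConverseCMSevenSplit_iff_heegnerNonTorsion`).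
[cite: BurungaleEtAl2026, Thm. 1 and Cor. 1 (arXiv:2312.09301, §0.1) — p odd]
[cite: BurungaleCastellaSkinnerTian2022, Rem. D (p. 327)] -/
@[conjecture] def HeegnerNonTorsionCMSevenAdditiveTwo : Prop :=
  ∀ (W : WeierstrassCurve ℚ) [W.IsElliptic] [W.IsGloballyMinimal] [NeZero (W.conductorNorm ℤ)],
    W.j = -3375 → ¬ W.HasGoodReductionAtPrime 2 →
    ∀ (K : Type) [Field K] [NumberField K], IsImaginaryQuadratic K →
      SatisfiesHeegnerHypothesis (W.conductorNorm ℤ) K → SatisfiesHeegnerHypothesis 2 K →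
      NumberField.discr K % 8 = 1 →
      (W.quadraticTwist (NumberField.discr K : ℚ)).entireLFunction 1 ≠ 0 →
      (W.baseChange K).selmerCorank 2 = 1 →
      ∀ (P : (W.baseChange K).toAffine.Point), IsHeegnerPoint (W.conductorNorm ℤ) W K P →
        ¬ IsOfFinAddOrder P

/-! ## §2 The route-B leaf ⟺ Heegner non-torsion -/

/-- **The route-B leaf from Heegner non-torsion** (Gross–Zagier, no hypothesis at `2`): a Heegner
point exists over the Heegner field (`hHP`), it is non-torsion by the leaf, and
`ord_{s=1} L(W/K, s) = 1 ⟺ P_K ∉ W(K)_tors` (Gross–Zagier `hGZ` + the sign from Modularity `hmod`).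
[cite: GrossZagier1986, Thm. I.(6.3) with V.§2 and I.§7] [cite: Gross1991, (1.1)] -/
theorem kLevelTwoConverseCMSevenSplit_of_heegnerNonTorsion (hmod : ModularForms.exists_isNewformOf)
    (hGZ : ∀ (N : ℕ) [NeZero N] (W : WeierstrassCurve ℚ) (K : Type) [Field K] [NumberField K],
      gross_zagier N W K)
    (hHP : ∀ (W : WeierstrassCurve ℚ) (K : Type) [Field K] [NumberField K], exists_isHeegnerPoint W K)
    (hNT : HeegnerNonTorsionCMSevenAdditiveTwo) : KLevelTwoConverseCMSevenSplit := by
  intro W _ _ hj hbad K _ _ hK hHN hH2 hd8 hL1 hK1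
  haveI : NeZero (W.conductorNorm ℤ) := ⟨(W.conductorNorm_pos_holds).ne'⟩
  obtain ⟨P, hP⟩ := hHP W K hK hHN
  have hnt : ¬ IsOfFinAddOrder P := hNT W hj hbad K hK hHN hH2 hd8 hL1 hK1 P hP
  exact (analyticRankEK_eq_one_iff_heegner_nonTorsion_of_exists_isNewformOf W (W.conductorNorm ℤ) K
    (hGZ _ W K) hmod hK rfl hHN hP).mpr hnt

/-- **Heegner non-torsion from the route-B leaf** (the converse, same Gross–Zagier dictionary):
`ord_{s=1} L(W/K, s) = 1` forces every Heegner point of level `N_W` off the torsion.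
[cite: GrossZagier1986, Thm. I.(6.3) with V.§2] [cite: Gross1991, (1.1)] -/
theorem heegnerNonTorsion_of_kLevelTwoConverseCMSevenSplit (hmod : ModularForms.exists_isNewformOf)
    (hGZ : ∀ (N : ℕ) [NeZero N] (W : WeierstrassCurve ℚ) (K : Type) [Field K] [NumberField K],
      gross_zagier N W K)
    (hXL : KLevelTwoConverseCMSevenSplit) : HeegnerNonTorsionCMSevenAdditiveTwo := by
  intro W _ _ _ hj hbad K _ _ hK hHN hH2 hd8 hL1 hK1 P hP
  exact (analyticRankEK_eq_one_iff_heegner_nonTorsion_of_exists_isNewformOf W (W.conductorNorm ℤ) K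
    (hGZ _ W K) hmod hK rfl hHN hP).mp (hXL W hj hbad K hK hHN hH2 hd8 hL1 hK1)

/-- **Route-B leaf ⟺ Heegner non-torsion**, granted Modularity, Gross–Zagier and the `K`-rationality
of Heegner points. [cite: GrossZagier1986, Thm. I.(6.3) with V.§2] [cite: Gross1991, (1.1)] -/
theorem kLevelTwoConverseCMSevenSplit_iff_heegnerNonTorsion (hmod : ModularForms.exists_isNewformOf)
    (hGZ : ∀ (N : ℕ) [NeZero N] (W : WeierstrassCurve ℚ) (K : Type) [Field K] [NumberField K],
      gross_zagier N W K)
    (hHP : ∀ (W : WeierstrassCurve ℚ) (K : Type) [Field K] [NumberField K], exists_isHeegnerPoint W K) :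
    KLevelTwoConverseCMSevenSplit ↔ HeegnerNonTorsionCMSevenAdditiveTwo :=
  ⟨heegnerNonTorsion_of_kLevelTwoConverseCMSevenSplit hmod hGZ,
    kLevelTwoConverseCMSevenSplit_of_heegnerNonTorsion hmod hGZ hHP⟩

/-! ## §3 The crux from Heegner non-torsion -/

/-- **Crux K12₂″ (route decl, by name) from Heegner non-torsion at `2`**: `2`-parity (`hpar`),
Modularity (`hmod`), Hoffstein–Luo (`hHL`), Kato's finiteness at `2` for the rank-zero twin (`hKato`),
Gross–Zagier (`hGZ`), `K`-rationality of Heegner points (`hHP`), and the leaf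
`HeegnerNonTorsionCMSevenAdditiveTwo` (`hNT`) — file 2's route B with its `K`-level leaf unfolded one level.
[cite: DokchitserDokchitserAnnals2010, Thm. 1.4 and Cor. 4.20] [cite: HoffsteinLuo1997, Theorem (§1)]
[cite: GrossZagier1986, Thm. I.(6.3)] [cite: BurungaleCastellaSkinnerTian2022, Rem. D (p. 327)] -/
theorem rankOneTwoConverseCMSevenAdditiveTwo_of_heegnerNonTorsion
    (hpar : ∀ (W : WeierstrassCurve ℚ) [W.IsElliptic], p_parity W 2)
    (hmod : ModularForms.exists_isNewformOf) (hHL : HoffsteinLuo1997_exists_twist_L_one_ne_zero)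
    (hKato : ∀ (W : WeierstrassCurve ℚ) [W.IsElliptic], kato_finite_of_L_one_ne_zero W 2)
    (hGZ : ∀ (N : ℕ) [NeZero N] (W : WeierstrassCurve ℚ) (K : Type) [Field K] [NumberField K],
      gross_zagier N W K)
    (hHP : ∀ (W : WeierstrassCurve ℚ) (K : Type) [Field K] [NumberField K], exists_isHeegnerPoint W K)
    (hNT : HeegnerNonTorsionCMSevenAdditiveTwo) :
    Summit.BirchSwinnertonDyer.BirchSwinnertonDyer.Theses.GoldfeldAllTwistsTwoConverse.RankOneTwoConverseCMSevenAdditiveTwo :=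
  rankOneTwoConverseCMSevenAdditiveTwo_of_kLevelTwoConverseSplit hpar hmod hHL hKato
    (kLevelTwoConverseCMSevenSplit_of_heegnerNonTorsion hmod hGZ hHP hNT)

/-- **The same with Gross–Zagier–Kolyvagin over `ℚ` in place of Kato** (the route's own binder
`rank_eq_analyticRank_of_analyticRank_le_one`). [cite: GrossZagier1986, Thm. I.(6.3)]
[cite: DokchitserDokchitserAnnals2010, Thm. 1.4 and Cor. 4.20] -/
theorem rankOneTwoConverseCMSevenAdditiveTwo_of_heegnerNonTorsion_of_rank_eq_analyticRank
    (hpar : ∀ (W : WeierstrassCurve ℚ) [W.IsElliptic], p_parity W 2)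
    (hmod : ModularForms.exists_isNewformOf) (hHL : HoffsteinLuo1997_exists_twist_L_one_ne_zero)
    (hGZK : rank_eq_analyticRank_of_analyticRank_le_one)
    (hGZ : ∀ (N : ℕ) [NeZero N] (W : WeierstrassCurve ℚ) (K : Type) [Field K] [NumberField K],
      gross_zagier N W K)
    (hHP : ∀ (W : WeierstrassCurve ℚ) (K : Type) [Field K] [NumberField K], exists_isHeegnerPoint W K)
    (hNT : HeegnerNonTorsionCMSevenAdditiveTwo) :
    Summit.BirchSwinnertonDyer.BirchSwinnertonDyer.Theses.GoldfeldAllTwistsTwoConverse.RankOneTwoConverseCMSevenAdditiveTwo :=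
  rankOneTwoConverseCMSevenAdditiveTwo_of_kLevelTwoConverseSplit_of_rank_eq_analyticRank hpar hmod hHL
    hGZK (kLevelTwoConverseCMSevenSplit_of_heegnerNonTorsion hmod hGZ hHP hNT)

end Summit.BirchSwinnertonDyer.BirchSwinnertonDyer.Theorems.GoldfeldGoodTwists

end
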